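import Summits.BirchSwinnertonDyer.BirchSwinnertonDyer.Theorems.GenusKolyvaginAtTwoPowDvdShaCardAtTwoRTShaLadder
import HarnessLib

/-!
# Route `GenusKolyvaginAtTwo`, crux L_T `PowDvdShaCardAtTwoRT` (stmt-BirchSwinnertonDyer-23242), LINE 18 `plus_descent`,
# stub 3a‴/3a⁗ — TOOLBOX, steps (c)+(d): STRICT supply from RELAXED supply by pigeonhole (loss-free repair)

Seat `bsd-line-gk2-p2` g15 (PROVER seat 2/3, cell `bsd-f1-sign2`), `--supports 23242 --as helper`. THEOREMS ONLY (no
definition, no named fact, no `sorry`). BSD is not proved by any of this; neither is the crux.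

## The device (ours; pure algebra)

McCallum's Prop. 5.2 ([McCallumLMS1991] §5) supplies, at depth `r`, a Kolyvagin class of the required order AVOIDING any
prescribed subgroup on `≤ r` generators. In LINE 18 the classes are descended from the Heegner field `K` to `ℚ` and are a
priori only RELAXED at the primes ramified in `K`: they live in an ambient group `A = H¹(ℚ, E)` and their images under the
relaxation map `π` (localisation at the ramified primes) lie in a FINITE set `F` (inside `⊕_{p∣d_K} H¹(Gal(K_𝔭/ℚ_p), E(K_𝔭))`,
of order `≤ 2^{Σ i_p}`, gk2-p3 `…LocalKernelOneBit*`). The step (c) ladder (`…RTShaLadder`, `SymplecticModulesLadder`) wants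
STRICT classes (`π z = 0`, i.e. in `Ш(E/ℚ)`). This file converts one into the other WITHOUT LOSS OF ORDER, spending only
avoidance budget:

* `exists_sub_strict_of_relaxed_supply` — **pigeonhole repair**: if every finite set of `≤ B` elements is avoided by some
  `z ∈ R` with `m ∣ ord z` and `π z ∈ F`, then every finite set `s₀` with `#s₀ + #(F ∖ {0}) ≤ B` is avoided by some `z ∈ R`
  with `m ∣ ord z` and `π z = 0`. (Pick `z₁, z₂, …` successively, `z_i` avoiding `s₀ ∪ {z₁, …, z_{i-1}}`; either some
  `π z_i = 0`, or two images agree and `z_i − z_{i'}` is strict, still avoids `s₀`, and `ord z_i ∣ ord (z_i − z_{i'})`.)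
* `pow_dvd_natCard_primaryComponent_sha_of_relaxed_supply` — fed into the pairing-free Ш-ladder: a relaxed supply at
  depths `a_j` with avoidance budget `2j + #(F ∖ {0})` at rung `j` gives `p^{2 Σ a_j} ∣ #Ш(E/K)[p^∞]` — NO factor lost.

Reading for the pen (card `plus_descent.md` `## v4.4`, the WARNING «the budget may be spent ONCE»): on the rows with
`Σ_{p∣d_K} i_p = 1` the relaxation quotient has order `≤ 2`, `#(F ∖ {0}) ≤ 1`, and the repair needs budget `2j + 1` at
the `j`-th rung of either side — exactly McCallum's rank `r = 2j + 1` at odd depth and `< r = 2j + 2` at even depth: there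
the descended ladders are LOSS-FREE (`2·M₀ ≤ ord₂ g + ord₂ g′` given (a)+(b)), no parity bit and no genus budget needed.
For `Σ i_p ≥ 3` the repair wants `2^{Σ i_p} − 1` spare generators, more than Prop. 5.2's one or two: that is where (d) lives.

References: [McCallumLMS1991] §5 Prop. 5.2, p. 310 (the supply and the "simple induction"); Kramer 1981 Prop. 3 (the local
norm index at a ramified prime).
-/

noncomputable section

-- `Summit.<P>.<Sub>` repeats `BirchSwinnertonDyer` by the tree's layout convention (D-0017)
set_option linter.dupNamespace false

namespace Summit.BirchSwinnertonDyer.BirchSwinnertonDyer.Theorems.GenusExact.PlusDescent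

open _root_.WeierstrassCurve AddSubgroup
open Literature.GroupTheory.FiniteAbelian
open Summit.BirchSwinnertonDyer.BirchSwinnertonDyer.Theorems.GenusExact.CasselsTateNumberField

/-! ## §1 Pigeonhole repair (pure algebra) -/

section Repair

variable {A Q : Type*} [AddCommGroup A] [AddCommGroup Q]

/-- **Differences of avoiding elements.** If `z` avoids `⟨s⟩` (`⟨z⟩ ∩ ⟨s⟩ = 0`), `w ∈ s` and `w` avoids `⟨s₀⟩` for some
`s₀ ⊆ s`, then `z − w` avoids `⟨s₀⟩` and `ord z ∣ ord (z − w)`. [folklore] -/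
theorem addOrderOf_dvd_and_disjoint_zmultiples_sub {s₀ s : Finset A} (hs₀ : s₀ ⊆ s) {z w : A} (hws : w ∈ s)
    (hz : Disjoint (zmultiples z) (closure (s : Set A)))
    (hw : Disjoint (zmultiples w) (closure (s₀ : Set A))) :
    addOrderOf z ∣ addOrderOf (z - w) ∧ Disjoint (zmultiples (z - w)) (closure (s₀ : Set A)) := by
  have hwcl : w ∈ closure (s : Set A) := subset_closure (Finset.mem_coe.mpr hws)
  have hle : closure (s₀ : Set A) ≤ closure (s : Set A) := closure_mono (Finset.coe_subset.mpr hs₀)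
  refine ⟨?_, ?_⟩
  · rw [addOrderOf_dvd_iff_nsmul_eq_zero]
    refine (AddSubgroup.disjoint_def.mp hz) ((zmultiples z).nsmul_mem (mem_zmultiples z) _) ?_
    have h : addOrderOf (z - w) • z = addOrderOf (z - w) • w := by
      rw [← sub_eq_zero, ← smul_sub]; exact addOrderOf_nsmul_eq_zero (z - w)
    rw [h]
    exact (closure (s : Set A)).nsmul_mem hwcl _
  · rw [AddSubgroup.disjoint_def]
    intro v hv hv₀
    rw [AddSubgroup.mem_zmultiples_iff] at hv
    obtain ⟨c, rfl⟩ := hv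
    have hcz : c • z = c • (z - w) + c • w := by rw [smul_sub, sub_add_cancel]
    have hcz0 : c • z = 0 := (AddSubgroup.disjoint_def.mp hz) (zsmul_mem_zmultiples z c)
      (by rw [hcz]; exact (closure (s : Set A)).add_mem (hle hv₀) ((closure (s : Set A)).zsmul_mem hwcl c))
    have hvw : c • (z - w) = -(c • w) := by
      rw [eq_neg_iff_add_eq_zero, ← hcz, hcz0]
    have hneg : -(c • w) ∈ zmultiples w := (zmultiples w).neg_mem (zsmul_mem_zmultiples w c)
    have := (AddSubgroup.disjoint_def.mp hw) hneg (by rw [← hvw]; exact hv₀)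
    rw [hvw, this]

/-- **Strict supply from relaxed supply (pigeonhole repair).** Let `R ≤ A` (the relaxed classes), `π : A → Q` additive
(the relaxation map) and `F ⊆ Q` finite (the possible defects). If every finite `s ⊆ A` with `#s ≤ B` is avoided —
`⟨z⟩ ∩ ⟨s⟩ = 0` — by some `z ∈ R` with `m ∣ ord z` and `π z ∈ F`, then every finite `s₀ ⊆ A` with
`#s₀ + #(F ∖ {0}) ≤ B` is avoided by some `z ∈ R` with `m ∣ ord z` and `π z = 0`: no order is lost, only
`#(F ∖ {0})` avoidance generators are spent. [folklore] -/
theorem exists_sub_strict_of_relaxed_supply [DecidableEq Q] (R : AddSubgroup A) (π : A →+ Q) (F : Finset Q)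
    (m B : ℕ)
    (hsupply : ∀ s : Finset A, s.card ≤ B →
      ∃ z ∈ R, m ∣ addOrderOf z ∧ π z ∈ F ∧ Disjoint (zmultiples z) (closure (s : Set A)))
    (s₀ : Finset A) (hB : s₀.card + (F.erase 0).card ≤ B) :
    ∃ z ∈ R, m ∣ addOrderOf z ∧ π z = 0 ∧ Disjoint (zmultiples z) (closure (s₀ : Set A)) := by
  classical
  -- invariant: `s ⊇ s₀` = `s₀` and the picks so far, `G ⊆ F ∖ {0}` = their (pairwise distinct, nonzero) images,
  -- `n` = the remaining fuel `#(F ∖ {0}) − #G`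
  suffices key : ∀ (n : ℕ) (s : Finset A) (G : Finset Q), G ⊆ F.erase 0 → G.card + n = (F.erase 0).card →
      s₀ ⊆ s → s.card ≤ s₀.card + G.card →
      (∀ g ∈ G, ∃ w ∈ s, w ∈ R ∧ π w = g ∧ Disjoint (zmultiples w) (closure (s₀ : Set A))) →
      ∃ z ∈ R, m ∣ addOrderOf z ∧ π z = 0 ∧ Disjoint (zmultiples z) (closure (s₀ : Set A)) from
    key (F.erase 0).card s₀ ∅ (Finset.empty_subset _) (by simp) subset_rfl (by simp) (by simp)
  intro n
  induction n with
  | zero =>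
    intro s G hGF hGc hs₀ hsc hG
    obtain ⟨z, hzR, hm, hzF, hz⟩ := hsupply s (by omega)
    by_cases h0 : π z = 0
    · exact ⟨z, hzR, hm, h0, hz.mono_right (closure_mono (Finset.coe_subset.mpr hs₀))⟩
    · have hGeq : G = F.erase 0 := Finset.eq_of_subset_of_card_le hGF (by omega)
      have hzG : π z ∈ G := by rw [hGeq]; exact Finset.mem_erase.mpr ⟨h0, hzF⟩
      obtain ⟨w, hws, hwR, hπw, hw⟩ := hG _ hzG
      obtain ⟨hdvd, hdisj⟩ := addOrderOf_dvd_and_disjoint_zmultiples_sub hs₀ hws hz hw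
      exact ⟨z - w, R.sub_mem hzR hwR, hm.trans hdvd, by rw [map_sub, hπw, sub_self], hdisj⟩
  | succ n ih =>
    intro s G hGF hGc hs₀ hsc hG
    obtain ⟨z, hzR, hm, hzF, hz⟩ := hsupply s (by omega)
    by_cases h0 : π z = 0
    · exact ⟨z, hzR, hm, h0, hz.mono_right (closure_mono (Finset.coe_subset.mpr hs₀))⟩
    by_cases hzG : π z ∈ G
    · obtain ⟨w, hws, hwR, hπw, hw⟩ := hG _ hzG
      obtain ⟨hdvd, hdisj⟩ := addOrderOf_dvd_and_disjoint_zmultiples_sub hs₀ hws hz hw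
      exact ⟨z - w, R.sub_mem hzR hwR, hm.trans hdvd, by rw [map_sub, hπw, sub_self], hdisj⟩
    · -- a new image: record it and recurse
      have hzs : z ∉ s := fun hzs ↦ by
        have h1 : z ∈ zmultiples z ⊓ closure (s : Set A) :=
          AddSubgroup.mem_inf.mpr ⟨mem_zmultiples z, subset_closure (Finset.mem_coe.mpr hzs)⟩
        rw [hz.eq_bot, AddSubgroup.mem_bot] at h1
        exact h0 (by rw [h1, map_zero])
      refine ih (insert z s) (insert (π z) G) ?_ ?_ (hs₀.trans (Finset.subset_insert z s)) ?_ ?_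
      · exact Finset.insert_subset (Finset.mem_erase.mpr ⟨h0, hzF⟩) hGF
      · rw [Finset.card_insert_of_notMem hzG]; omega
      · rw [Finset.card_insert_of_notMem hzs, Finset.card_insert_of_notMem hzG]; omega
      · intro g hg
        rcases Finset.mem_insert.mp hg with rfl | hg
        · exact ⟨z, Finset.mem_insert_self z s, hzR, rfl,
            hz.mono_right (closure_mono (Finset.coe_subset.mpr hs₀))⟩
        · obtain ⟨w, hws, hwR, hπw, hw⟩ := hG g hg
          exact ⟨w, Finset.mem_insert_of_mem hws, hwR, hπw, hw⟩

end Repair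

/-! ## §2 The loss-free ladder in `Ш(E/K)[p^∞]` from a relaxed supply -/

variable {K : Type} [Field K] [NumberField K] (V : WeierstrassCurve K) [V.IsElliptic] (p : ℕ) [hp : Fact p.Prime]

/-- **The loss-free ladder from a relaxed supply.** Let `Ш(E/K)[p^∞]` be finite inside `A = H¹(K, E)`; let `R ≤ A` be
the relaxed classes, `π : A → Q` the relaxation map with finite defect set `F`, and suppose a relaxed class with no
defect is strict (`z ∈ R`, `π z = 0 ⟹ z ∈ Ш(E/K)[p^∞]`). If for every `j < k` every finite `s ⊆ A` with
`#s ≤ 2j + #(F ∖ {0})` is avoided by a class `z ∈ R` with `p^{a_j} ∣ ord z` and `π z ∈ F` (McCallum's Prop. 5.2 shape,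
with `#(F ∖ {0})` spare generators), then `p^{2(a₀ + ⋯ + a_{k-1})} ∣ #Ш(E/K)[p^∞]` — no factor is lost to the
relaxation. [cite: McCallumLMS1991, §5 Prop. 5.2 and p. 310] -/
theorem pow_dvd_natCard_primaryComponent_sha_of_relaxed_supply
    [Finite (AddCommGroup.primaryComponent V.sha p)] {Q : Type*} [AddCommGroup Q] [DecidableEq Q]
    (R : AddSubgroup V.galH1) (π : V.galH1 →+ Q) (F : Finset Q)
    (hstrict : ∀ z ∈ R, π z = 0 → z ∈ (AddCommGroup.primaryComponent V.sha p).map V.sha.subtype)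
    (k : ℕ) (a : ℕ → ℕ)
    (hsupply : ∀ j < k, ∀ s : Finset V.galH1, s.card ≤ 2 * j + (F.erase 0).card →
      ∃ z ∈ R, p ^ a j ∣ addOrderOf z ∧ π z ∈ F ∧ Disjoint (zmultiples z) (closure (s : Set V.galH1))) :
    p ^ (2 * ∑ j ∈ Finset.range k, a j) ∣ Nat.card (AddCommGroup.primaryComponent V.sha p) := by
  refine pow_dvd_natCard_primaryComponent_sha_of_relaxed_avoidance V p k (fun _ ↦ 1) a (fun _ _ ↦ one_ne_zero) ?_
  intro j hj s _ hcard
  obtain ⟨z, hzR, hm, hπ, hz⟩ :=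
    exists_sub_strict_of_relaxed_supply R π F (p ^ a j) (2 * j + (F.erase 0).card) (hsupply j hj) s (by omega)
  refine ⟨z, ?_, ?_, hz⟩
  · simpa only [one_mul] using hm
  · simpa only [one_smul] using hstrict z hzR hπ

/-- **The loss-free ladder from a relaxed supply, valuation form**: `2(a₀ + ⋯ + a_{k-1}) ≤ ord_p #Ш(E/K)[p^∞]` under the
hypotheses of `pow_dvd_natCard_primaryComponent_sha_of_relaxed_supply`. [cite: McCallumLMS1991, §5 Prop. 5.2 and p. 310] -/
theorem two_mul_sum_le_padicValNat_natCard_primaryComponent_sha_of_relaxed_supply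
    [Finite (AddCommGroup.primaryComponent V.sha p)] {Q : Type*} [AddCommGroup Q] [DecidableEq Q]
    (R : AddSubgroup V.galH1) (π : V.galH1 →+ Q) (F : Finset Q)
    (hstrict : ∀ z ∈ R, π z = 0 → z ∈ (AddCommGroup.primaryComponent V.sha p).map V.sha.subtype)
    (k : ℕ) (a : ℕ → ℕ)
    (hsupply : ∀ j < k, ∀ s : Finset V.galH1, s.card ≤ 2 * j + (F.erase 0).card →
      ∃ z ∈ R, p ^ a j ∣ addOrderOf z ∧ π z ∈ F ∧ Disjoint (zmultiples z) (closure (s : Set V.galH1))) :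
    2 * ∑ j ∈ Finset.range k, a j ≤ padicValNat p (Nat.card (AddCommGroup.primaryComponent V.sha p)) := by
  rw [← padicValNat_dvd_iff_le (Nat.card_pos (α := AddCommGroup.primaryComponent V.sha p)).ne']
  exact pow_dvd_natCard_primaryComponent_sha_of_relaxed_supply V p R π F hstrict k a hsupply

end Summit.BirchSwinnertonDyer.BirchSwinnertonDyer.Theorems.GenusExact.PlusDescent

end
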